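import Mathlib
import Summits.Ventures.PercRepro2.ZMeanProof
import Summits.Ventures.PercRepro2.BHKEvents
import Summits.Ventures.PercRepro2.HMFLeaf

/-!
# The mean-field T-row inequality for arbitrary weights

For any probability vector `p`, graph `ends`, roots `a₁ ≠ a₂` and markers `o, b`, with
`Q = {a₁ ↮ a₂}` and the T-row sum `Y_T = Σ_W P(Q, C(a₂) = W) · termT(W)` of `ZMean`:

`P(Q) · Y_T ≤ P(Q, a₁ ↔ o) · (P(Q, a₂ ↔ b) − P(Q, a₁ ↔ b))`   (`mfT_le`).

This is the sign argument of `HMFPendantRoot` (night-1 g6) with the pinned edge removed: the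
T-row term is the cluster functional `g_o(C₂) (1_{b ∈ C₂} − g_b(C₂))` of the heavy root cluster,
whose expectation is `P(Q, oL, bH) − E[1_Q g_o g_b]`; the cross-cluster BHK inequality bounds the
first term and the same-cluster BHK inequality (applied to the monotone `1 − g_o`, `1 − g_b`)
the second.  Applied to the pocket-zeroed weights it discharges the bracket hypotheses of
`PocketConn.HMF_pocket_of_beta`.
-/

namespace Summit.Ventures.PercRepro2

open UnionCluster CovForm PendantRoot

namespace PocketConn

variable {V : Type*} {E : Type*} [Fintype E] [DecidableEq E] [Fintype V] [DecidableEq V]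
  {R : Type*} [Field R] [LinearOrder R] [IsStrictOrderedRing R]

variable (p : E → R) (ends : E → Sym2 V)

/-- The residual share `g_v(S) = P_{G∖S}(a₁ ↔ v)`. -/
noncomputable def gshare (a₁ v : V) : Set V → R :=
  delClusterProb p ends a₁ {S : Set V | v ∈ S}

omit [LinearOrder R] [IsStrictOrderedRing R] in
/-- On a cluster `W ∌ a₁` the residual connection probability is `g_v(W)`. -/
lemma delConnProb_eq_gshare {W : Finset V} {a₁ : V} (h1 : a₁ ∉ W) (v : V) :
    delConnProb p ends W a₁ v = gshare p ends a₁ v (↑W : Set V) := by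
  classical
  have hset : {ω : Config E | cluster ends (delConfig ends (↑W : Set V) ω) a₁ ∈
      {S : Set V | v ∈ S}} = connDelEvent ends W a₁ v := by
    ext ω
    simp only [Set.mem_setOf_eq, mem_cluster, mem_connDelEvent, delConfig_eq_restrict]
  unfold gshare delClusterProb delConnProb
  rw [hset]
  by_cases hv : v ∈ W
  · rw [if_pos hv, connDelEvent_eq_empty ends h1 hv, prob_empty]
  · rw [if_neg hv]

/-- The T-row functional `1_{a₁ ∉ S} · g_o(S) · (1_{b ∈ S} − g_b(S))`. -/
noncomputable def FT (o a₁ b : V) : Set V → R := fun S =>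
  ({T : Set V | a₁ ∉ T}).indicator 1 S *
    (gshare p ends a₁ o S * (({T : Set V | b ∈ T}).indicator 1 S - gshare p ends a₁ b S))

omit [LinearOrder R] [IsStrictOrderedRing R] in
/-- On a cluster `W ∌ a₁`, `termT(W) = FT(W)`. -/
lemma termT_eq_FT {W : Finset V} (o a₁ b : V) (h1 : a₁ ∉ W) :
    termT p ends W o a₁ b = FT p ends o a₁ b (↑W : Set V) := by
  have h1' : (↑W : Set V) ∈ {T : Set V | a₁ ∉ T} := fun h => h1 (Finset.mem_coe.1 h)
  simp only [termT, FT, delConnProb_eq_gshare p ends h1, Set.indicator_of_mem h1', Pi.one_apply,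
    one_mul]
  by_cases hb : b ∈ W
  · have hgb : gshare p ends a₁ b (↑W : Set V) = 0 := by
      rw [← delConnProb_eq_gshare p ends h1 b]
      simp [delConnProb, hb]
    rw [if_pos hb, Set.indicator_of_mem (show (↑W : Set V) ∈ {T : Set V | b ∈ T} from
      Finset.mem_coe.2 hb), hgb]
    simp
  · rw [if_neg hb, Set.indicator_of_notMem (show (↑W : Set V) ∉ {T : Set V | b ∈ T} from
      fun h => hb (Finset.mem_coe.1 h))]
    ring

omit [Fintype V] [DecidableEq V] [LinearOrder R] [IsStrictOrderedRing R] in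
/-- `FT` vanishes on clusters containing `a₁`. -/
lemma FT_of_mem {W : Finset V} (o a₁ b : V) (h1 : a₁ ∈ W) : FT p ends o a₁ b (↑W : Set V) = 0 := by
  simp only [FT]
  rw [Set.indicator_of_notMem (show (↑W : Set V) ∉ {T : Set V | a₁ ∉ T} from
    fun h => h (Finset.mem_coe.2 h1)), zero_mul]

omit [LinearOrder R] [IsStrictOrderedRing R] in
/-- `Σ_W P(Q, C(a₂) = W) · termT(W) = E[FT(C(a₂))]`. -/
lemma sum_T_eq_expect (o a₁ a₂ b : V) :
    ∑ W : Finset V, prob p ((connEvent ends a₁ a₂)ᶜ ∩ clusterEvent ends a₂ (↑W : Set V)) *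
        termT p ends W o a₁ b =
      expect p (fun ω => FT p ends o a₁ b (cluster ends ω a₂)) := by
  have h := HMFPendantRoot.sum_prob_clusterEvent_inter_mul p ends a₂ Set.univ
    (FT p ends o a₁ b)
  simp only [Set.inter_univ, Set.indicator_univ, Pi.one_apply, one_mul] at h
  rw [← h]
  refine Finset.sum_congr rfl fun W _ => ?_
  by_cases h1 : a₁ ∈ W
  · have hempty : (connEvent ends a₁ a₂)ᶜ ∩ clusterEvent ends a₂ (↑W : Set V) = ∅ := by
      ext ω
      simp only [Set.mem_inter_iff, Set.mem_compl_iff, mem_connEvent, mem_clusterEvent,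
        Set.mem_empty_iff_false, iff_false, not_and]
      intro hQ hW
      apply hQ
      have : a₁ ∈ cluster ends ω a₂ := by
        rw [hW]
        exact Finset.mem_coe.2 h1
      exact conn_symm this
    rw [hempty, prob_empty, zero_mul, FT_of_mem p ends o a₁ b h1, mul_zero]
  · have heq : (connEvent ends a₁ a₂)ᶜ ∩ clusterEvent ends a₂ (↑W : Set V) =
        clusterEvent ends a₂ (↑W : Set V) := by
      ext ω
      simp only [Set.mem_inter_iff, Set.mem_compl_iff, mem_connEvent, mem_clusterEvent,
        and_iff_right_iff_imp]
      intro hW h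
      have : a₁ ∈ cluster ends ω a₂ := conn_symm h
      rw [hW] at this
      exact h1 (Finset.mem_coe.1 this)
    rw [heq, termT_eq_FT p ends o a₁ b h1]

/-- `E[1_Q · g_o(C₂) · g_b(C₂)]`: the Rao–Blackwellised same-side product. -/
noncomputable def Eprod' (o a₁ a₂ b : V) : R :=
  expect p (fun ω => gshare p ends a₁ o (cluster ends ω a₂) * gshare p ends a₁ b (cluster ends ω a₂) *
    ((connEvent ends a₂ a₁)ᶜ).indicator 1 ω)

omit [DecidableEq V] [LinearOrder R] [IsStrictOrderedRing R] in
/-- `E[FT(C₂)] = P(bH, oL, Q) − E[1_Q g_o g_b]`. -/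
lemma expect_FT (o a₁ a₂ b : V) :
    expect p (fun ω => FT p ends o a₁ b (cluster ends ω a₂)) =
      prob p (connEvent ends a₂ b ∩ connEvent ends a₁ o ∩ (connEvent ends a₂ a₁)ᶜ) -
        Eprod' p ends o a₁ a₂ b := by
  have h1 := prob_clusterIn_inter_eq_expect p ends a₂ a₁ {S : Set V | b ∈ S} {S : Set V | o ∈ S}
  rw [clusterInEvent_mem_eq, clusterInEvent_mem_eq] at h1
  rw [h1]
  unfold Eprod'
  rw [← expect_sub]
  refine congrArg _ (funext fun ω => ?_)
  simp only [FT, Pi.sub_apply, gshare]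
  have hQ : ((connEvent ends a₂ a₁)ᶜ).indicator (1 : Config E → R) ω =
      ({T : Set V | a₁ ∉ T}).indicator 1 (cluster ends ω a₂) := by
    by_cases h : a₁ ∈ cluster ends ω a₂
    · rw [Set.indicator_of_notMem (show ω ∉ (connEvent ends a₂ a₁)ᶜ from fun h' => h' h),
        Set.indicator_of_notMem (show cluster ends ω a₂ ∉ {T : Set V | a₁ ∉ T} from
          fun h' => h' h)]
    · rw [Set.indicator_of_mem (show ω ∈ (connEvent ends a₂ a₁)ᶜ from h),
        Set.indicator_of_mem (show cluster ends ω a₂ ∈ {T : Set V | a₁ ∉ T} from h)]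
      rfl
  rw [hQ]
  ring

/-- **Same-cluster BHK in functional form**: `P(Q, oL) · P(Q, bL) ≤ E[1_Q g_o g_b] · P(Q)`. -/
lemma bhk_same_gshare (hp : IsProbVec p) (o a₁ a₂ b : V) :
    prob p (connEvent ends a₁ o ∩ (connEvent ends a₂ a₁)ᶜ) *
        prob p (connEvent ends a₁ b ∩ (connEvent ends a₂ a₁)ᶜ) ≤
      Eprod' p ends o a₁ a₂ b * prob p (connEvent ends a₂ a₁)ᶜ := by
  classical
  have hup : ∀ v : V, IsUpperSet {S : Set V | v ∈ S} := fun v _ _ hST h => hST h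
  have hanti : ∀ v : V, Antitone (gshare p ends a₁ v) := fun v =>
    delClusterProb_anti p hp ends a₁ (hup v)
  have hle1 : ∀ v S, gshare p ends a₁ v S ≤ 1 := fun v S => delClusterProb_le_one p hp ends a₁ _ S
  have hmono : ∀ v : V, Monotone (fun S => 1 - gshare p ends a₁ v S) := fun v S T hST => by
    have := hanti v hST; linarith
  have hnn : ∀ v : V, ∀ S, 0 ≤ 1 - gshare p ends a₁ v S := fun v S => by
    have := hle1 v S; linarith
  have key := bhk_same_cluster p hp ends a₂ a₁ (hmono o) (hmono b) (hnn o) (hnn b)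
  have eo := prob_clusterIn_inter_eq_expect p ends a₂ a₁ Set.univ {S : Set V | o ∈ S}
  have eb := prob_clusterIn_inter_eq_expect p ends a₂ a₁ Set.univ {S : Set V | b ∈ S}
  simp only [Set.indicator_univ, Pi.one_apply, one_mul, clusterInEvent_mem_eq] at eo eb
  have eu : clusterInEvent ends a₂ Set.univ = Set.univ := by ext; simp [clusterInEvent]
  rw [eu, Set.univ_inter] at eo eb
  have hQ : prob p (connEvent ends a₂ a₁)ᶜ =
      expect p (fun ω => ((connEvent ends a₂ a₁)ᶜ).indicator 1 ω) := prob_eq_expect_indicator _ _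
  have l1 : expect p (fun ω => (1 - gshare p ends a₁ o (cluster ends ω a₂)) *
      ((connEvent ends a₂ a₁)ᶜ).indicator 1 ω) =
      prob p (connEvent ends a₂ a₁)ᶜ - prob p (connEvent ends a₁ o ∩ (connEvent ends a₂ a₁)ᶜ) := by
    rw [eo, hQ, ← expect_sub]
    refine congrArg _ (funext fun ω => ?_)
    simp only [Pi.sub_apply, gshare]; ring
  have l2 : expect p (fun ω => (1 - gshare p ends a₁ b (cluster ends ω a₂)) *
      ((connEvent ends a₂ a₁)ᶜ).indicator 1 ω) =
      prob p (connEvent ends a₂ a₁)ᶜ - prob p (connEvent ends a₁ b ∩ (connEvent ends a₂ a₁)ᶜ) := by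
    rw [eb, hQ, ← expect_sub]
    refine congrArg _ (funext fun ω => ?_)
    simp only [Pi.sub_apply, gshare]; ring
  have l3 : expect p (fun ω => (1 - gshare p ends a₁ o (cluster ends ω a₂)) *
      (1 - gshare p ends a₁ b (cluster ends ω a₂)) * ((connEvent ends a₂ a₁)ᶜ).indicator 1 ω) =
      prob p (connEvent ends a₂ a₁)ᶜ - prob p (connEvent ends a₁ o ∩ (connEvent ends a₂ a₁)ᶜ) -
        prob p (connEvent ends a₁ b ∩ (connEvent ends a₂ a₁)ᶜ) + Eprod' p ends o a₁ a₂ b := by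
    rw [eo, eb, hQ]
    unfold Eprod'
    rw [← expect_sub, ← expect_sub, ← expect_add]
    refine congrArg _ (funext fun ω => ?_)
    simp only [Pi.sub_apply, Pi.add_apply, gshare]; ring
  rw [l1, l2, l3] at key
  nlinarith [key]

/-- **Cross-cluster BHK**: `P(bH, oL, Q) · P(Q) ≤ P(oL, Q) · P(bH, Q)`. -/
lemma bhk_cross_gshare (hp : IsProbVec p) (o a₁ a₂ b : V) :
    prob p (connEvent ends a₂ b ∩ connEvent ends a₁ o ∩ (connEvent ends a₂ a₁)ᶜ) *
        prob p (connEvent ends a₂ a₁)ᶜ ≤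
      prob p (connEvent ends a₁ o ∩ (connEvent ends a₂ a₁)ᶜ) *
        prob p (connEvent ends a₂ b ∩ (connEvent ends a₂ a₁)ᶜ) := by
  have key := bhk_cross_cluster p hp ends a₁ a₂
    (𝓤 := {S : Set V | o ∈ S}) (𝓥 := {S : Set V | b ∈ S}) (fun _ _ hST h => hST h)
    (fun _ _ hST h => hST h)
  rw [clusterInEvent_mem_eq, clusterInEvent_mem_eq, connEvent_comm ends a₁ a₂] at key
  have e : connEvent ends a₁ o ∩ connEvent ends a₂ b ∩ (connEvent ends a₂ a₁)ᶜ =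
      connEvent ends a₂ b ∩ connEvent ends a₁ o ∩ (connEvent ends a₂ a₁)ᶜ := by
    rw [Set.inter_comm (connEvent ends a₁ o)]
  rw [e] at key
  exact key

/-- **The mean-field T-row inequality**:
`P(Q) · Σ_W P(Q, C(a₂) = W) · termT(W) ≤ P(Q, a₁ ↔ o) · (P(Q, a₂ ↔ b) − P(Q, a₁ ↔ b))`. -/
theorem mfT_le (hp : IsProbVec p) (o a₁ a₂ b : V) :
    prob p (connEvent ends a₁ a₂)ᶜ *
        ∑ W : Finset V, prob p ((connEvent ends a₁ a₂)ᶜ ∩ clusterEvent ends a₂ (↑W : Set V)) *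
          termT p ends W o a₁ b ≤
      prob p ((connEvent ends a₁ a₂)ᶜ ∩ connEvent ends a₁ o) *
        (prob p ((connEvent ends a₁ a₂)ᶜ ∩ connEvent ends a₂ b) -
          prob p ((connEvent ends a₁ a₂)ᶜ ∩ connEvent ends a₁ b)) := by
  rw [sum_T_eq_expect, expect_FT, connEvent_comm ends a₁ a₂]
  have hs := bhk_same_gshare p ends hp o a₁ a₂ b
  have hc := bhk_cross_gshare p ends hp o a₁ a₂ b
  rw [Set.inter_comm (connEvent ends a₁ o) (connEvent ends a₂ a₁)ᶜ,
    Set.inter_comm (connEvent ends a₁ b) (connEvent ends a₂ a₁)ᶜ] at hs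
  rw [Set.inter_comm (connEvent ends a₁ o) (connEvent ends a₂ a₁)ᶜ,
    Set.inter_comm (connEvent ends a₂ b) (connEvent ends a₂ a₁)ᶜ] at hc
  nlinarith [hs, hc]

end PocketConn

end Summit.Ventures.PercRepro2
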